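import Summits.QuantumFields.YangMills.Theorems.BalabanUVNodesN13UVRowDepthIndexedAtRecord13

/-!
# BalabanUVNodes ∕ N13 — THE DEPTH-INDEXED (UV₁₃) ROW KEYED ON THE RUN-WISE β-FLOOR: [I] (0.31)'s lower half along the windowed runs
# (`DagBinding.BetaBoundsInInterval w.C.toB12 w.γ w.b w.βup`, the K1⁷ v6 world's currency) instead of the box-wide `BetaLowerH`

Cell `pub-ymgap` (HUMAN RULING D-0062 Track A; D-0149 width seat `pub-ymgap-dag-n13-w1`, g3, CLAIM-4), key K1⁷ `StabilityBAtRecordR13SepCoPH` = stmt-QuantumFields-20542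
(`--kind proof --supports … --as helper`).  [III] = [Balaban1988Convergent], [B16] = [Balaban1989LargeFieldII], [I] = [Balaban1987RG1].

WHY THIS FILE.  CLAIM-1 (`…N13UVRowDepthIndexedAtRecord13`, p600126) keyed the remaining-depth bound `(K − k)·b < g_k⁻²` — and with it the depth-indexed reading of K1⁷'s Cor-3
conjunct ∕ the engines' `hUV` binder — on the BOX-WIDE lower β-box `FlowStep.BetaLowerH b γ β₁₃(θ)` (`b ≤ β_k(v)` at every prefix `v ∈ ]0,γ]^{k+1}`).  The K1⁷ v6 road (plan g82
03:16Z; dag-n24-w1 p600421 `…K1EndAtPinX3HSFourPinOfRunRows`) DROPS that box-wide `hlo` from the children's hypotheses: what the world-level headline of the skeleton of record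
(`K1Skeleton13SepCoPHV6.endStatementBPrinted_of_recordS_of_nodes`, via `Node00.endStatementBPrinted_of_nodesP_interval_guarded`) still reads is the RUN-WISE two-sided bound
`hβ : DagBinding.BetaBoundsInInterval w.C.toB12 w.γ w.b w.βup` (`0 < w.b` a field of `WorldP`) — the β-functions OF THE RUNS at points of `]0, w.γ]` after an in-window past,
i.e. exactly the input of [I] Thm 2's (0.31) (`DagBinding.discrete031_along`: (0.20) + run-wise bounds ⇒ `1∕g² + b(K−k) ≤ 1∕g_k² ≤ 1∕g² + β′(K−k)`).  The remaining-depth bound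
needs ONLY (0.31)'s LOWER HALF along the run, so the whole depth-indexed reading survives the re-cut in the v6 world's own currency.  THIS FILE: §1 (generic `B16.Construction`)
`remainingSteps_mul_lt_inv_sq_of_rgEq_of_lowerAlong` ((0.20) telescoped, `Step.inv_sq_telescope`, + the run-wise floor ⇒ `(K−k)·b < g_k⁻²`), `hdepth_of_betaBoundsInInterval`
(the depth hypothesis of CLAIM-1's `cor3With_of_depthIndexed` from `BetaBoundsInInterval C.toB12 γ₀ b b′` + (0.20) on the windowed runs), ★ `cor3With_of_depthIndexed_of_betaBoundsInInterval`,
`cor3_250_of_depthIndexed_of_betaBoundsInInterval`; §2 (the record, N-generic) `satisfiesRG_datumOfRecord₁₃SepCoPH_of_inInterval` ((0.20) holds along every windowed run of the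
datum of record — its flow IS `genFlow β₁₃(θ) g₀`, `FlowStepRuns.satisfiesRG_of_inInterval`), ★★ `cor3With_datumOfRecord₁₃SepCoPH_of_depthIndexed_of_betaBoundsInInterval`,
`cor3_250_datumOfRecord₁₃SepCoPH_of_depthIndexed_of_betaBoundsInInterval`, ★★ `hUV₁₃_of_depthIndexed_of_betaBoundsInInterval` (the engines' `hUV` binder at a world `w` with
`w.C = (datumOfRecord₁₃SepCoPH θ h).C` from depth-indexed bounds + the world's OWN `hβ : BetaBoundsInInterval w.C.toB12 w.γ w.b w.βup` — the K1⁷ v6 headline's hypothesis verbatim).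

HONEST FRAMING.  Count-neutral reading ∕ supplier-shape bookkeeping (telescoped (0.20) + the run-wise floor); `0 < w.b` ∕ `b > 0` is NODE O's unprinted run-wise lower β-bound
([I] Thm 2 (0.31)'s lower half, T09.F `betaPositive`), DISPLAYED — never asserted; nothing of Bałaban's asserted; (U)∕(L) content NOT supplied; N13 NOT discharged; K0⁷∕K1⁷ NOT
closed; counts unmoved (5∕27 · A 5∕28); one finite `𝕋⁴_{L^K}` programme at fixed `ε = L^{−K}` — R4 closes the conditional finite-𝕋⁴ rung `BalabanLadder.UV` only; the YM mass gap
(Clay) is NOT proved by any of this.  No `def`, no `sorry`, no `instance`.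
-/

noncomputable section

open scoped BigOperators Matrix.Norms.L2Operator

namespace Summit.QuantumFields.YangMills.BalabanUVNodes.N13UVRowDepthIndexedOfRunwiseBetaFloor

open Literature.MathematicalPhysics.QuantumFieldTheory.Balaban1983to89
open Literature.MathematicalPhysics.QuantumFieldTheory.Balaban1983to89.T4Continuum (T4Family)
open Literature.MathematicalPhysics.QuantumFieldTheory.Balaban1983to89.Node00
open FlowStepRuns (genSeq genFlow satisfiesRG_of_inInterval modelOf_forwardGenerated modelOf_haltsOutside modelOf_curries)
open DagBinding (WorldP BetaBoundsInInterval alongRun_of_inInterval)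
open Summit.QuantumFields.YangMills.BalabanUVNodes.N13UVRowDepthIndexedAtRecord13
  (cor3With_of_depthIndexed exists_dominating_of_depthBound)

/-! ## §1 Generic constructions: (0.20) along the run + the run-wise β-floor ⇒ the remaining depth is bounded by the coupling -/

section Generic

/-- **`(K − k)·b < g_k⁻²` FROM (0.20) TELESCOPED AND THE RUN-WISE FLOOR** (`Step` currency): if `1∕g_j² = 1∕g_{j+1}² + β_{j+1}(g_j)` for `j < K` (`Step.RGEq`), `b ≤ β_{j+1}(g_j)` for
`j < K` and `0 < g_K`, then for every `k ≤ K`: `(K − k)·b ≤ 1∕g_k² − 1∕g_K² < 1∕g_k²` ([I] (0.31)'s lower half without its endpoint letter; `Step.inv_sq_telescope`).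
[cite: Balaban1987RG1, (0.20) p.256, Thm 2 (0.31) p.259 (bookkeeping)] -/
theorem remainingSteps_mul_lt_inv_sq_of_rgEq_of_lowerAlong {K : ℕ} {β : ℕ → ℝ → ℝ} {g : ℕ → ℝ} {b : ℝ} (h : Step.RGEq K β g)
    (hlo : ∀ j, j < K → b ≤ β (j + 1) (g j)) (hK : 0 < g K) {k : ℕ} (hk : k ≤ K) :
    ((K - k : ℕ) : ℝ) * b < ((g k) ^ 2)⁻¹ := by
  have tel := Step.inv_sq_telescope h hk le_rfl
  have hsum : ∑ _j ∈ Finset.Ico k K, b ≤ ∑ j ∈ Finset.Ico k K, β (j + 1) (g j) :=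
    Finset.sum_le_sum fun j hj => hlo j (Finset.mem_Ico.1 hj).2
  have hcard : ∑ _j ∈ Finset.Ico k K, b = ((K - k : ℕ) : ℝ) * b := by
    rw [Finset.sum_const, Nat.card_Ico, nsmul_eq_mul]
  have hpos : 0 < 1 / (g K) ^ 2 := by positivity
  rw [hcard] at hsum
  rw [← one_div]
  linarith

variable (C : B16.Construction)

/-- **THE DEPTH HYPOTHESIS OF CLAIM-1's `cor3With_of_depthIndexed` FROM THE RUN-WISE β-BOUNDS**: if every windowed run of `C` obeys (0.20) (`SatisfiesRG`) and the run-wise two-sided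
bound `BetaBoundsInInterval C.toB12 γ₀ b b′` holds on `]0, γ₀] ⊇ ]0, γ]`, then along every windowed run `(K − k)·b < g_k⁻²` for `k ≤ K` (only the LOWER half `b ≤ β_{j+1}(g_j)` is read,
`DagBinding.alongRun_of_inInterval`). [cite: Balaban1987RG1, (0.20) p.256, (1.22) p.264, Thm 2 (0.31) p.259 (bookkeeping)] -/
theorem hdepth_of_betaBoundsInInterval {γ₀ γ b b' : ℝ} (hβ : BetaBoundsInInterval C.toB12 γ₀ b b') (hγ : γ ≤ γ₀)
    (hRG : ∀ P : B12.RunParams, (C P).flow.InInterval γ P.K → (C P).flow.SatisfiesRG P.K) :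
    ∀ P : B12.RunParams, (C P).flow.InInterval γ P.K → ∀ k, k ≤ P.K → ((P.K - k : ℕ) : ℝ) * b < (((C P).flow.g k) ^ 2)⁻¹ :=
  fun P hP _ hk =>
    remainingSteps_mul_lt_inv_sq_of_rgEq_of_lowerAlong ((Step.rgEq_iff _ _).1 (hRG P hP)) (alongRun_of_inInterval C.toB12 hβ hγ P hP).1 (hP P.K le_rfl).1 hk

/-- **★ `Cor3With` FROM DEPTH-INDEXED TWO-SIDED BOUNDS, KEYED ON THE RUN-WISE β-FLOOR** — CLAIM-1's `cor3With_of_depthIndexed` with its depth hypothesis discharged from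
`BetaBoundsInInterval C.toB12 γ₀ b b′` (`γ ≤ γ₀`) + (0.20) on the windowed runs; `em, ep` any functions dominating `Em, Ep` on the qualifying depths.
[cite: Balaban1988Convergent, Cor. 3 (2.50) p.264; Balaban1989LargeFieldII, (0.1) pp.355–356; Balaban1987RG1, Thm 2 (0.31) p.259] -/
theorem cor3With_of_depthIndexed_of_betaBoundsInInterval {γ₀ γ b b' : ℝ} (hsign : B16.SignConventions C)
    (hβ : BetaBoundsInInterval C.toB12 γ₀ b b') (hγ : γ ≤ γ₀)
    (hRG : ∀ P : B12.RunParams, (C P).flow.InInterval γ P.K → (C P).flow.SatisfiesRG P.K)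
    (Em Ep : ℝ → ℕ → ℝ) (em ep : ℝ → ℝ)
    (hem : ∀ x : ℝ, 0 < x → ∀ n : ℕ, (n : ℝ) * b < (x ^ 2)⁻¹ → Em x n ≤ em x)
    (hep : ∀ x : ℝ, 0 < x → ∀ n : ℕ, (n : ℝ) * b < (x ^ 2)⁻¹ → Ep x n ≤ ep x)
    (hUV : ∀ P : B12.RunParams, (C P).flow.InInterval γ P.K → ∀ k, k ≤ P.K → ∀ V : (C P).Cfg k,
      B16.UVIneq (C P) k V (Em ((C P).flow.g k) (P.K - k)) (Ep ((C P).flow.g k) (P.K - k))) :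
    B16.Cor3With C γ em ep :=
  cor3With_of_depthIndexed C γ b hsign (hdepth_of_betaBoundsInInterval C hβ hγ hRG) Em Ep em ep hem hep hUV

/-- **`Cor3_250` FROM A DEPTH-INDEXED FAMILY, KEYED ON THE RUN-WISE β-FLOOR** (`0 < b`, `0 < γ ≤ γ₀`). [cite: Balaban1988Convergent, Cor. 3 (2.50) p.264; Balaban1989LargeFieldII, (0.1) pp.355–356] -/
theorem cor3_250_of_depthIndexed_of_betaBoundsInInterval {γ₀ γ b b' : ℝ} (hγ0 : 0 < γ) (hb : 0 < b) (hsign : B16.SignConventions C)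
    (hβ : BetaBoundsInInterval C.toB12 γ₀ b b') (hγ : γ ≤ γ₀)
    (hRG : ∀ P : B12.RunParams, (C P).flow.InInterval γ P.K → (C P).flow.SatisfiesRG P.K)
    (Em Ep : ℝ → ℕ → ℝ)
    (hUV : ∀ P : B12.RunParams, (C P).flow.InInterval γ P.K → ∀ k, k ≤ P.K → ∀ V : (C P).Cfg k,
      B16.UVIneq (C P) k V (Em ((C P).flow.g k) (P.K - k)) (Ep ((C P).flow.g k) (P.K - k))) :
    B16.Cor3_250 C := by
  obtain ⟨em, hem⟩ := exists_dominating_of_depthBound hb Em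
  obtain ⟨ep, hep⟩ := exists_dominating_of_depthBound hb Ep
  exact ⟨γ, hγ0, em, ep, cor3With_of_depthIndexed_of_betaBoundsInInterval C hsign hβ hγ hRG Em Ep em ep hem hep hUV⟩

end Generic

/-! ## §2 At NODE 00's Stage-13 datum of record: (0.20) is automatic along windowed runs; the run-wise floor is the K1⁷ v6 world's `hβ` -/

section Record

variable {F : T4Family} {N : ℕ} [NeZero N] (θ : Stage13HParams F N) (h : θ.Provisos₁₃SepCoPH F N)

/-- **(0.20) ALONG EVERY WINDOWED RUN OF THE DATUM OF RECORD**: the datum's flow IS `genFlow β₁₃(θ) g₀` (def-T's `datumOfTower`), generated forward by `solveCoupling`, so in the window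
the RG equations hold (`FlowStepRuns.satisfiesRG_of_inInterval` at the canonical model `modelOf β₁₃(θ)`). [cite: Balaban1987RG1, (0.18)–(0.20) pp.255–256 (bookkeeping)] -/
theorem satisfiesRG_datumOfRecord₁₃SepCoPH_of_inInterval {γ : ℝ} (P : B12.RunParams)
    (hP : ((datumOfRecord₁₃SepCoPH F N θ h).C P).flow.InInterval γ P.K) :
    ((datumOfRecord₁₃SepCoPH F N θ h).C P).flow.SatisfiesRG P.K :=
  satisfiesRG_of_inInterval (modelOf_forwardGenerated (betaOfRecord₁₃ F N θ.toStage13Params)) (modelOf_haltsOutside _) (modelOf_curries _)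
    ⟨P.K, 0, P.g0⟩ (γ := γ) hP

/-- **★★ K1⁷'s COR.-3 CONJUNCT AT THE RECORD FROM DEPTH-INDEXED TWO-SIDED BOUNDS, KEYED ON THE RUN-WISE β-FLOOR** — `B16.Cor3With (datumOfRecord₁₃SepCoPH θ h).C γ em ep` from:
`BetaBoundsInInterval (datumOfRecord₁₃SepCoPH θ h).C.toB12 γ₀ b b′` (ONLY its lower half is read; the K1⁷ v6 world's currency), `γ ≤ γ₀`, (0.1) at every windowed `(P, k ≤ K, V)`
with constants `Em(g_k, K−k)`, `Ep(g_k, K−k)`, and any `em, ep` dominating them on the qualifying depths `n·b < (x²)⁻¹`; sign convention K0e's `chiFix29OfRecord_mem_Icc`; (0.20) by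
`satisfiesRG_datumOfRecord₁₃SepCoPH_of_inInterval`. [cite: Balaban1988Convergent, Cor. 3 (2.50) p.264; Balaban1989LargeFieldII, (0.1) pp.355–356; Balaban1987RG1, (0.20) p.256, Thm 2 (0.31) p.259, (2.9) p.266] -/
theorem cor3With_datumOfRecord₁₃SepCoPH_of_depthIndexed_of_betaBoundsInInterval {γ₀ γ b b' : ℝ}
    (hβ : BetaBoundsInInterval (datumOfRecord₁₃SepCoPH F N θ h).C.toB12 γ₀ b b') (hγ : γ ≤ γ₀)
    (Em Ep : ℝ → ℕ → ℝ) (em ep : ℝ → ℝ)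
    (hem : ∀ x : ℝ, 0 < x → ∀ n : ℕ, (n : ℝ) * b < (x ^ 2)⁻¹ → Em x n ≤ em x)
    (hep : ∀ x : ℝ, 0 < x → ∀ n : ℕ, (n : ℝ) * b < (x ^ 2)⁻¹ → Ep x n ≤ ep x)
    (hUV : ∀ P : B12.RunParams, ((datumOfRecord₁₃SepCoPH F N θ h).C P).flow.InInterval γ P.K → ∀ k, k ≤ P.K → ∀ V : GaugeField (F.P P.K) k (SU N),
      B16.UVIneq ((datumOfRecord₁₃SepCoPH F N θ h).C P) k V (Em (gOfRecord₁₃ F N θ.toStage13Params P k) (P.K - k))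
        (Ep (gOfRecord₁₃ F N θ.toStage13Params P k) (P.K - k))) :
    B16.Cor3With (datumOfRecord₁₃SepCoPH F N θ h).C γ em ep :=
  cor3With_of_depthIndexed_of_betaBoundsInInterval _ (fun P k V => (chiFix29OfRecord_mem_Icc θ.ν θ.ε₂₉ P.K k V).1) hβ hγ
    (fun P hP => satisfiesRG_datumOfRecord₁₃SepCoPH_of_inInterval θ h P hP) Em Ep em ep hem hep hUV

/-- **`Cor3_250` AT THE RECORD FROM A DEPTH-INDEXED FAMILY, KEYED ON THE RUN-WISE β-FLOOR** (`0 < γ ≤ γ₀`, `0 < b`).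
[cite: Balaban1988Convergent, Cor. 3 (2.50) p.264; Balaban1989LargeFieldII, (0.1) pp.355–356, p.391; Balaban1987RG1, Thm 2 (0.31) p.259] -/
theorem cor3_250_datumOfRecord₁₃SepCoPH_of_depthIndexed_of_betaBoundsInInterval {γ₀ γ b b' : ℝ} (hγ0 : 0 < γ) (hb : 0 < b)
    (hβ : BetaBoundsInInterval (datumOfRecord₁₃SepCoPH F N θ h).C.toB12 γ₀ b b') (hγ : γ ≤ γ₀) (Em Ep : ℝ → ℕ → ℝ)
    (hUV : ∀ P : B12.RunParams, ((datumOfRecord₁₃SepCoPH F N θ h).C P).flow.InInterval γ P.K → ∀ k, k ≤ P.K → ∀ V : GaugeField (F.P P.K) k (SU N),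
      B16.UVIneq ((datumOfRecord₁₃SepCoPH F N θ h).C P) k V (Em (gOfRecord₁₃ F N θ.toStage13Params P k) (P.K - k))
        (Ep (gOfRecord₁₃ F N θ.toStage13Params P k) (P.K - k))) :
    B16.Cor3_250 (datumOfRecord₁₃SepCoPH F N θ h).C :=
  cor3_250_of_depthIndexed_of_betaBoundsInInterval _ hγ0 hb (fun P k V => (chiFix29OfRecord_mem_Icc θ.ν θ.ε₂₉ P.K k V).1) hβ hγ
    (fun P hP => satisfiesRG_datumOfRecord₁₃SepCoPH_of_inInterval θ h P hP) Em Ep hUV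

/-- **★★ THE ENGINES' `hUV` BINDER FROM DEPTH-INDEXED TWO-SIDED BOUNDS IN A WORLD `w` BOUND TO THE RECORD, KEYED ON THE WORLD'S OWN RUN-WISE β-BOUNDS** — `w.C = (datumOfRecord₁₃SepCoPH θ h).C`
(the `RecordS` ∕ four-pin binding) and `hβ : BetaBoundsInInterval w.C.toB12 w.γ w.b w.βup` VERBATIM as the K1⁷ v6 skeleton's world-level headline `endStatementBPrinted_of_recordS_of_nodes`
reads it (`0 < w.b` a field of `WorldP`); given a family of two-sided bounds guarded like `hUV` (window + `SLaw₁₃CoPH`) with constants `Em(g_k, K−k)`, `Ep(g_k, K−k)` and the dominations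
`E x n ≤ w.e x` on `n·w.b < (x²)⁻¹`, the conclusion is the engines' `hUV` hypothesis LETTER FOR LETTER.  CLAIM-1's `hUV₁₃_of_depthIndexed` is the box-wide-`hlo` twin.
[cite: Balaban1989LargeFieldII, Thm 1 p.355, (0.1) pp.355–356; Balaban1988Convergent, Cor. 3 (2.50) p.264; Balaban1987RG1, (0.20) p.256, Thm 2 (0.31) p.259, (2.9) p.266] -/
theorem hUV₁₃_of_depthIndexed_of_betaBoundsInInterval (w : WorldP) (hC : w.C = (datumOfRecord₁₃SepCoPH F N θ h).C)
    (hβ : BetaBoundsInInterval w.C.toB12 w.γ w.b w.βup) (Em Ep : ℝ → ℕ → ℝ)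
    (hem : ∀ x : ℝ, 0 < x → ∀ n : ℕ, (n : ℝ) * w.b < (x ^ 2)⁻¹ → Em x n ≤ w.em x)
    (hep : ∀ x : ℝ, 0 < x → ∀ n : ℕ, (n : ℝ) * w.b < (x ^ 2)⁻¹ → Ep x n ≤ w.ep x)
    (hUVd : ∀ P : B12.RunParams, (genFlow (betaOfRecord₁₃ F N θ.toStage13Params) P.g0).InInterval w.γ P.K → ∀ k, k ≤ P.K → SLaw₁₃CoPH F N θ P k →
      ∀ U : GaugeField (F.P P.K) k (SU N),
        chiβOfRecord₁₃ F N θ.toStage13Params P.K (gOfRecord₁₃ F N θ.toStage13Params P) k U *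
              Real.exp (-(1 / (gOfRecord₁₃ F N θ.toStage13Params P k) ^ 2 * wilsonBGOfRecord F N θ.toStage13Params.εbg P k U)
                - Em (gOfRecord₁₃ F N θ.toStage13Params P k) (P.K - k) * (Fintype.card (Site (F.P P.K) k) : ℝ)) ≤ densOfRecord₁₃ F N θ.toStage13Params P k U ∧
        densOfRecord₁₃ F N θ.toStage13Params P k U ≤
          Real.exp (Ep (gOfRecord₁₃ F N θ.toStage13Params P k) (P.K - k) * (Fintype.card (Site (F.P P.K) k) : ℝ))) :
    ∀ P : B12.RunParams, (genFlow (betaOfRecord₁₃ F N θ.toStage13Params) P.g0).InInterval w.γ P.K → ∀ k, k ≤ P.K → SLaw₁₃CoPH F N θ P k →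
      ∀ U : GaugeField (F.P P.K) k (SU N),
        chiβOfRecord₁₃ F N θ.toStage13Params P.K (gOfRecord₁₃ F N θ.toStage13Params P) k U *
              Real.exp (-(1 / (gOfRecord₁₃ F N θ.toStage13Params P k) ^ 2 * wilsonBGOfRecord F N θ.toStage13Params.εbg P k U)
                - w.em (gOfRecord₁₃ F N θ.toStage13Params P k) * (Fintype.card (Site (F.P P.K) k) : ℝ)) ≤ densOfRecord₁₃ F N θ.toStage13Params P k U ∧
        densOfRecord₁₃ F N θ.toStage13Params P k U ≤ Real.exp (w.ep (gOfRecord₁₃ F N θ.toStage13Params P k) * (Fintype.card (Site (F.P P.K) k) : ℝ)) := by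
  intro P hP k hk hS U
  obtain ⟨hlow, hup⟩ := hUVd P hP k hk hS U
  have hg : 0 < gOfRecord₁₃ F N θ.toStage13Params P k := (hP k hk).1
  have hβ' : BetaBoundsInInterval (datumOfRecord₁₃SepCoPH F N θ h).C.toB12 w.γ w.b w.βup := hC ▸ hβ
  have hd : ((P.K - k : ℕ) : ℝ) * w.b < ((gOfRecord₁₃ F N θ.toStage13Params P k) ^ 2)⁻¹ :=
    hdepth_of_betaBoundsInInterval (datumOfRecord₁₃SepCoPH F N θ h).C hβ' le_rfl
      (fun Q hQ => satisfiesRG_datumOfRecord₁₃SepCoPH_of_inInterval θ h Q hQ) P hP k hk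
  have hχ : 0 ≤ chiβOfRecord₁₃ F N θ.toStage13Params P.K (gOfRecord₁₃ F N θ.toStage13Params P) k U :=
    (chiFix29OfRecord_mem_Icc θ.ν θ.ε₂₉ P.K k U).1
  have hT : (0 : ℝ) ≤ (Fintype.card (Site (F.P P.K) k) : ℝ) := Nat.cast_nonneg _
  have hm := mul_le_mul_of_nonneg_right (hem _ hg _ hd) hT
  have hp := mul_le_mul_of_nonneg_right (hep _ hg _ hd) hT
  exact ⟨le_trans (mul_le_mul_of_nonneg_left (Real.exp_le_exp.mpr (by linarith)) hχ) hlow, hup.trans (Real.exp_le_exp.mpr hp)⟩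

end Record

end Summit.QuantumFields.YangMills.BalabanUVNodes.N13UVRowDepthIndexedOfRunwiseBetaFloor

end
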